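import Summits.QuantumFields.BalabanUV.Beta.EriceRemainderEnclosureHistoryAutonomyComparisonAgeCompositionTailSums

/-!
# EriceRemainderEnclosureHistoryAutonomyComparisonAgeCompositionStaticWiring — (E81g) TOOLS FOR THE STATIC END: the tail-sum comparison LOCALISED to a
# tail that is already non-decreasing (for downward inductions in the pin), the PER-PIN HARNACK GROWTH of an old surplus from the chain's drop ratios
# ((E71c) `harnack_step` at lag one: `(1 − Ω⁰_m)·v_{m+1} ≤ (1 + Σ_k θ_k(m;1)β_k)·v_m`), and LINEARITY of the zero-tailed solution operators (so that
# monotonicity statements for all admissible inputs follow from the truncations `1_{[0,j]}`)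

Cell `pub-balaban`, β-function sub-cell, BINDER row D4 «RemainderConst leaves for Bałaban's split» (`HOME/BINDER-OWNERS.md`; owner lineage `b2b-balaban-beta-an4`;
this file by co-owner #2 lineage `b2b-balaban-beta-d4-p2`, generation 72), β-FLOW TEAM duty (1), FREEZE (0) honoured (def-free; imports (E81f) `…TailSums`;
uses (E71a) `read_sum`∕`sol_unique`∕`sol_eq_zero_of_tail`, (E71c) `harnack_step`, (E80d) `older_read_eq`, (E81f) `scaled_read_le_of_tail_sums` BY NAME;
nothing restated).

HONEST FRAMING (page 1, verbatim and binding).  *"Discharging BetaPertH makes Bałaban's UV stability UNCONDITIONAL — a real constructive-QFT result; it is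
NOT the continuum limit and NOT the Clay problem."*  THIS FILE DISCHARGES NOTHING OF THE KIND.  Elementary real algebra about ABSTRACT kernels and
triangular systems — hypotheses of a census, not facts; the age profile of Bałaban's (1.22) limit functional is NOT PRINTED ([I] p. 298; GAPS G-t4-U2-1∕-2)
and NOT asserted.  Row D4 class UNCHANGED (critical-path width 0; instance 0∕1; D4 DISCHARGE NO DATE).  HONEST DEPENDENCY: continuum YM on T⁴ ⇐ BetaPertH
∧ nine spine estimates (0/9 proved); BetaPertH ⇐ (D1) ∧ (D4) ∧ CAP+tail; G-an2-4 gates asym, D1 and NE2/3/4.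

THE POINT (census sense (α); route (N); README `g72/e81/README.md` §5).  Three pieces of wiring between (E81f)'s static tail-sum comparison and the
induction over the ages: §1 **`scaled_read_le_of_tail_sums_local`** — the same comparison when the input is known to be non-decreasing with controlled growth
only from the depth `n+1` on (the form a DOWNWARD INDUCTION IN THE PIN needs; proof: apply (E81f) to the input frozen at `v (n+1)` above the pin); §2
**`per_pin_growth_of_drop_ratios`** — in (E80d)'s letters, the lag-one case of (E71c) `harnack_step`: at a pin where the drops of the older ages are bounded
by carried ratios, `(1 − Σ_{k∈(i,n]} KL k m 0)·v (m+1) ≤ (1 + Σ_{k∈(i,n]} θ k m 1·β_k)·v m` — the per-pin growth factor `H1_m` of README §5 (numerics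
`g72/numerics/m16.py`: attained along flows); §3 LINEARITY: reads are linear (`read_lincomb`), zero-tailed solution operators are linear (`sol_lincomb`, by
uniqueness), an admissible input is the non-negative combination `Σ_{j≤N}(w_j − w_{j+1})·1_{[0,j]}` of truncations (`eq_sum_truncations`), hence
**`antitone_of_truncations`**: a pin-monotonicity statement for the composite `w ↦ RL i (SL i (SA (i+1) w))` (or any composite of such operators) holds
for every admissible input once it holds for the truncations.  NOT CLAIMED: the static families for the flow; anything printed.

WHAT IS PROVED ([folklore]; 0 `def`, 0 sorry).  §1 **`scaled_read_le_of_tail_sums_local`**.  §2 `filter_lt_one`, **`per_pin_growth_of_drop_ratios`**.  §3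
`read_lincomb`, **`sol_lincomb`**, `truncation_tail`, `eq_sum_truncations`, **`antitone_of_truncations`**.  §4 (APPEND, same generation, for (E81j)):
**`per_pin_growth_sharp`** — the lag-one growth with the ENTERING lags credited where the surplus is known to be non-decreasing across the window:
`(1 − Σ_k(KL k m 0 − s_k·KL k (m+1)(y_k−1)))·v (m+1) ≤ (1 + Σ_kθ k m 1·β_k)·v m` (the plain form over-books the lag-zero reads as lost; `g72/numerics/m20`–`m21`).
-/
noncomputable section
open Finset

namespace Summit.QuantumFields.BalabanUV.Beta.EriceRemainderEnclosureHistoryAutonomyComparisonAgeCompositionStaticWiring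

open Summit.QuantumFields.BalabanUV.Beta.EriceRemainderEnclosureHistoryAutonomyComparisonAgeComposition
open Summit.QuantumFields.BalabanUV.Beta.EriceRemainderEnclosureHistoryAutonomyComparisonAgeCompositionHarnack
open Summit.QuantumFields.BalabanUV.Beta.EriceRemainderEnclosureHistoryAutonomyComparisonAgeCompositionChainWiring
open Summit.QuantumFields.BalabanUV.Beta.EriceRemainderEnclosureHistoryAutonomyComparisonAgeCompositionTailSums

/-! ## §1 The tail-sum comparison localised to a monotone tail -/

/-- **SCALED READ COMPARISON, LOCAL FORM.**  As (E81f) `scaled_read_le_of_tail_sums`, but the input is only required to be non-decreasing and of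
controlled growth on the depths `≥ n+1` (below the edge `j`).  (Apply the global form to the input frozen at the value `v (n+1)` above the depth `n+1` with
growth factor `1` there; the two reads only see the depths `≥ n+1`.) [folklore] -/
theorem scaled_read_le_of_tail_sums_local {N y : ℕ} {K : ℕ → ℕ → ℝ} {R : (ℕ → ℝ) → ℕ → ℝ}
    (hR : ∀ v n, R v n = ∑ l ∈ range N, K n l * v (n + 1 + l)) (hK : ∀ n l, 0 ≤ K n l)
    (hKy : ∀ n l, y ≤ l → K n l = 0) (hy : 1 ≤ y) (hyN : y ≤ N)
    {v : ℕ → ℝ} {j n : ℕ} (hv0 : ∀ m, 0 ≤ v m) (hvj : ∀ m, j < m → v m = 0) (hmono : ∀ m, n + 1 ≤ m → m < j → v m ≤ v (m + 1))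
    {H : ℕ → ℝ} (hgrow : ∀ m, n + 1 ≤ m → m < j → v (m + 1) ≤ H m * v m) {c : ℝ} (hc : 0 ≤ c)
    (hfull : n + 1 + y ≤ j → ∀ L', L' < y → c * ∑ l ∈ Ico L' y, H (n + 1 + l) * K (n + 1) l ≤ ∑ l ∈ Ico L' y, K n l)
    (hpart : ∀ L, n + 1 + L = j → L < y → ∀ L', L' ≤ L → c * ∑ l ∈ Ico L' L, H (n + 1 + l) * K (n + 1) l ≤ ∑ l ∈ Ico L' (L + 1), K n l) :
    c * R v (n + 1) ≤ R v n := by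
  -- the frozen input and growth factor
  set vt : ℕ → ℝ := fun m => if m ≤ n then v (n + 1) else v m with hvt
  set Ht : ℕ → ℝ := fun m => if m ≤ n then 1 else H m with hHt
  have hagree : ∀ m, n + 1 ≤ m → vt m = v m := fun m hm => by simp only [hvt]; rw [if_neg (by omega)]
  have hRn : ∀ n', n ≤ n' → R vt n' = R v n' := fun n' hn' => by
    rw [hR, hR]; exact sum_congr rfl fun l _ => by rw [hagree _ (by omega)]
  have h := scaled_read_le_of_tail_sums hR hK hKy hy hyN (v := vt) (j := j) (H := Ht) (c := c) (n := n)
    (fun m => by simp only [hvt]; split_ifs <;> exact hv0 _)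
    (fun m hm => by
      simp only [hvt]; split_ifs with h1
      · exact hvj _ (by omega)
      · exact hvj _ hm)
    (fun m hm => by
      simp only [hvt]
      rcases Nat.lt_or_ge m n with h1 | h1
      · rw [if_pos h1.le, if_pos (by omega)]
      · rcases eq_or_lt_of_le h1 with h2 | h2
        · subst h2; rw [if_pos le_rfl, if_neg (by omega)]
        · rw [if_neg (by omega), if_neg (by omega)]; exact hmono m (by omega) hm)
    (fun m hm => by
      simp only [hvt, hHt]
      rcases Nat.lt_or_ge m n with h1 | h1
      · rw [if_pos h1.le, if_pos (by omega), if_pos h1.le, one_mul]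
      · rcases eq_or_lt_of_le h1 with h2 | h2
        · subst h2; rw [if_pos le_rfl, if_neg (by omega), if_pos le_rfl, one_mul]
        · rw [if_neg (by omega), if_neg (by omega), if_neg (by omega)]; exact hgrow m (by omega) hm)
    hc
    (fun hj L' hL' => by
      have e : ∀ l ∈ Ico L' y, Ht (n + 1 + l) * K (n + 1) l = H (n + 1 + l) * K (n + 1) l := fun l _ => by
        simp only [hHt]; rw [if_neg (by omega)]
      rw [sum_congr rfl e]; exact hfull hj L' hL')
    (fun L hL hLy L' hL' => by
      have e : ∀ l ∈ Ico L' L, Ht (n + 1 + l) * K (n + 1) l = H (n + 1 + l) * K (n + 1) l := fun l _ => by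
        simp only [hHt]; rw [if_neg (by omega)]
      rw [sum_congr rfl e]; exact hpart L hL hLy L' hL')
  rwa [hRn (n + 1) (by omega), hRn n le_rfl] at h

/-! ## §2 The per-pin Harnack growth of an old surplus from the chain's drop ratios -/

section Growth

variable {N n : ℕ} {KL KA : ℕ → ℕ → ℕ → ℝ} {RL RA : ℕ → (ℕ → ℝ) → ℕ → ℝ} {θ : ℕ → ℕ → ℕ → ℝ}

/-- `(range N).filter (· < 1) = range 1` for `1 ≤ N`. [folklore] -/
theorem filter_lt_one (hN : 1 ≤ N) : (range N).filter (· < 1) = range 1 := by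
  ext l; simp only [mem_filter, mem_range]; omega

/-- **THE PER-PIN GROWTH OF AN OLD SURPLUS.**  Level `i` of (E80d)'s induction (lone kernels `KL ≥ 0` on the horizon `N ≥ 1`, aggregates `KA`, persistence
defects `θ ≥ 0`); `v ≥ 0` the surplus of the ages `> i` for a non-increasing input `w` (`v = w − RA (i+1) v`); at the pin `m` the drops of the older ages are
bounded by carried ratios, `RL k v m ≤ β_k·v m` (`i < k ≤ n`), and the old lag-zero mass `Ω⁰ = Σ_{k∈(i,n]} KL k m 0 < 1`.  Then
**`(1 − Ω⁰)·v (m+1) ≤ (1 + Σ_{k∈(i,n]} θ k m 1·β_k)·v m`** — (E71c) `harnack_step` at lag one. [folklore] -/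
theorem per_pin_growth_of_drop_ratios
    (hKL : ∀ i m l, 0 ≤ KL i m l) (hKLN : ∀ i m l, N ≤ l → KL i m l = 0) (hN : 1 ≤ N)
    (hRL : ∀ i v m, RL i v m = ∑ l ∈ range N, KL i m l * v (m + 1 + l))
    (hRA : ∀ i v m, RA i v m = ∑ l ∈ range N, KA i m l * v (m + 1 + l))
    (hKA : ∀ i m l, KA i m l = KL i m l + KA (i + 1) m l) (hKAtop : ∀ m l, KA (n + 1) m l = 0)
    (hθ0 : ∀ k m l, 0 ≤ θ k m l) (hpers : ∀ k m l i', (1 - θ k m l) * KL k m (i' + l) ≤ KL k (m + l) i')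
    {i : ℕ} (hin : i ≤ n) {v w : ℕ → ℝ} (hv0 : ∀ m, 0 ≤ v m) (hw : ∀ m, w (m + 1) ≤ w m) (heq : ∀ m, v m = w m - RA (i + 1) v m)
    {m : ℕ} {β : ℕ → ℝ} (hdrop : ∀ k, i < k → k ≤ n → RL k v m ≤ β k * v m) :
    (1 - ∑ k ∈ Ioc i n, KL k m 0) * v (m + 1) ≤ (1 + ∑ k ∈ Ioc i n, θ k m 1 * β k) * v m := by
  have heq' : ∀ m', v m' = w m' - ∑ k ∈ range (n + 1), ∑ l ∈ range N, (if i < k then KL k m' l else 0) * v (m' + 1 + l) :=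
    fun m' => by rw [heq m', older_read_eq hRA hKA hKAtop hin v m']
  have hst := harnack_step (E := fun k m' l => if i < k then KL k m' l else 0) (θ := θ) (A := n + 1) (N := N)
    (fun k m' l hl => by split_ifs; exacts [hKLN k m' l hl, rfl]) hv0 hw heq' (m := m) (l := 1)
    (fun k _ i' => by
      split_ifs
      · exact hpers k m 1 i'
      · simp)
  -- the lag-zero part: Σ_k E k m 0 · v (m+1)
  have hset : (range (n + 1)).filter (fun k => i < k) = Ioc i n := by
    ext k; simp only [mem_filter, mem_range, mem_Ioc]; omega
  have h0 : ∑ k ∈ range (n + 1), ∑ l ∈ (range N).filter (· < 1), (if i < k then KL k m l else 0) * v (m + 1 + l) =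
      (∑ k ∈ Ioc i n, KL k m 0) * v (m + 1) := by
    rw [filter_lt_one hN, sum_mul, ← sum_filter_add_sum_filter_not (range (n + 1)) (fun k => i < k)]
    have hz : ∑ k ∈ (range (n + 1)).filter (fun k => ¬ i < k), ∑ l ∈ range 1, (if i < k then KL k m l else 0) * v (m + 1 + l) = 0 :=
      sum_eq_zero fun k hk => sum_eq_zero fun l _ => by rw [mem_filter] at hk; rw [if_neg hk.2, zero_mul]
    rw [hz, add_zero, hset]
    exact sum_congr rfl fun k hk => by rw [sum_range_one, if_pos (mem_Ioc.mp hk).1, add_zero]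
  -- the shifted part: ≤ Σ_k θ k m 1 · RL k v m ≤ (Σ θ β) v m
  have h1 : ∑ k ∈ range (n + 1), θ k m 1 * ∑ l ∈ (range N).filter (1 ≤ ·), (if i < k then KL k m l else 0) * v (m + 1 + l) ≤
      (∑ k ∈ Ioc i n, θ k m 1 * β k) * v m := by
    rw [sum_mul, ← sum_filter_add_sum_filter_not (range (n + 1)) (fun k => i < k)]
    have hz : ∑ k ∈ (range (n + 1)).filter (fun k => ¬ i < k),
        θ k m 1 * ∑ l ∈ (range N).filter (1 ≤ ·), (if i < k then KL k m l else 0) * v (m + 1 + l) = 0 :=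
      sum_eq_zero fun k hk => by
        rw [mem_filter] at hk
        rw [sum_eq_zero fun l _ => by rw [if_neg hk.2, zero_mul], mul_zero]
    rw [hz, add_zero, hset]
    refine sum_le_sum fun k hk => ?_
    have hk' := mem_Ioc.mp hk
    have hpart : ∑ l ∈ (range N).filter (1 ≤ ·), (if i < k then KL k m l else 0) * v (m + 1 + l) ≤ RL k v m := by
      rw [hRL]
      refine (sum_le_sum_of_subset_of_nonneg (filter_subset _ _) fun l _ _ => ?_).trans (le_of_eq (sum_congr rfl fun l _ => by rw [if_pos hk'.1]))
      rw [if_pos hk'.1]; exact mul_nonneg (hKL k m l) (hv0 _)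
    calc θ k m 1 * ∑ l ∈ (range N).filter (1 ≤ ·), (if i < k then KL k m l else 0) * v (m + 1 + l) ≤ θ k m 1 * RL k v m :=
          mul_le_mul_of_nonneg_left hpart (hθ0 k m 1)
      _ ≤ θ k m 1 * (β k * v m) := mul_le_mul_of_nonneg_left (hdrop k hk'.1 hk'.2) (hθ0 k m 1)
      _ = θ k m 1 * β k * v m := by ring
  rw [h0] at hst
  nlinarith [hst, h1]

end Growth

/-! ## §3 Linearity of reads and solution operators; admissible inputs from truncations -/

section Linear

variable {N : ℕ} {K : ℕ → ℕ → ℝ} {R : (ℕ → ℝ) → ℕ → ℝ} {S : (ℕ → ℝ) → ℕ → ℝ}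

/-- Reads are linear: `R (Σ_j a_j·u_j) n = Σ_j a_j·R u_j n`. [folklore] -/
theorem read_lincomb (hR : ∀ v n, R v n = ∑ l ∈ range N, K n l * v (n + 1 + l)) (s : Finset ℕ) (a : ℕ → ℝ) (u : ℕ → ℕ → ℝ) (n : ℕ) :
    R (fun m => ∑ j ∈ s, a j * u j m) n = ∑ j ∈ s, a j * R (u j) n := by
  rw [hR]; simp_rw [hR, mul_sum]; rw [sum_comm]
  exact sum_congr rfl fun j _ => sum_congr rfl fun l _ => by ring

/-- **ZERO-TAILED SOLUTION OPERATORS ARE LINEAR**: for zero-tailed inputs `u_j`, `S (Σ_j a_j·u_j) = Σ_j a_j·S u_j` (uniqueness of the zero-tailed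
solution). [folklore] -/
theorem sol_lincomb (hR : ∀ v n, R v n = ∑ l ∈ range N, K n l * v (n + 1 + l))
    (hS : ∀ w : ℕ → ℝ, (∀ m, N < m → w m = 0) → (∀ m, N < m → S w m = 0) ∧ ∀ m, S w m = w m - R (S w) m)
    (s : Finset ℕ) (a : ℕ → ℝ) {u : ℕ → ℕ → ℝ} (hu : ∀ j ∈ s, ∀ m, N < m → u j m = 0) :
    ∀ m, S (fun m => ∑ j ∈ s, a j * u j m) m = ∑ j ∈ s, a j * S (u j) m := by
  have hwt : ∀ m, N < m → (fun m => ∑ j ∈ s, a j * u j m) m = 0 := fun m hm => by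
    simp only; exact sum_eq_zero fun j hj => by rw [hu j hj m hm, mul_zero]
  refine sol_unique hR (hS _ hwt).1 (hS _ hwt).2 (fun m hm => sum_eq_zero fun j hj => by rw [(hS _ (hu j hj)).1 m hm, mul_zero]) fun m => ?_
  rw [read_lincomb hR s a (fun j => S (u j)) m, ← sum_sub_distrib]
  exact sum_congr rfl fun j hj => by rw [(hS _ (hu j hj)).2 m]; ring

/-- Truncations have zero tail: `1_{[0,j]} m = 0` for `m > N ≥ j`. [folklore] -/
theorem truncation_tail {j : ℕ} (hj : j ≤ N) : ∀ m, N < m → (fun m => if m ≤ j then (1:ℝ) else 0) m = 0 :=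
  fun m hm => by simp only; rw [if_neg (by omega)]

/-- **AN ADMISSIBLE INPUT IS A NON-NEGATIVE COMBINATION OF TRUNCATIONS**: for `w` zero beyond `N`,
`w m = Σ_{j≤N} (w j − w (j+1))·1_{[0,j]}(m)`. [folklore] -/
theorem eq_sum_truncations {w : ℕ → ℝ} (hwt : ∀ m, N < m → w m = 0) (m : ℕ) :
    w m = ∑ j ∈ range (N + 1), (w j - w (j + 1)) * (if m ≤ j then (1:ℝ) else 0) := by
  rcases Nat.lt_or_ge N m with hm | hm
  · rw [hwt m hm]; exact (sum_eq_zero fun j hj => by rw [if_neg (by have := mem_range.mp hj; omega), mul_zero]).symm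
  · -- Σ_{j ≤ N} (w j − w (j+1))·[m ≤ j] = Σ_{j ∈ [m, N]} (w j − w (j+1)) = w m − w (N+1) = w m
    have hsplit : ∑ j ∈ range (N + 1), (w j - w (j + 1)) * (if m ≤ j then (1:ℝ) else 0) = ∑ j ∈ Ico m (N + 1), (w j - w (j + 1)) := by
      rw [← sum_range_add_sum_Ico _ (by omega : m ≤ N + 1)]
      rw [sum_eq_zero (s := range m) fun j hj => by rw [if_neg (by have := mem_range.mp hj; omega), mul_zero], zero_add]
      exact sum_congr rfl fun j hj => by rw [if_pos (mem_Ico.mp hj).1, mul_one]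
    rw [hsplit, sum_Ico_eq_sum_range, show N + 1 - m = N - m + 1 by omega]
    have key : ∑ k ∈ range (N - m + 1), (w (m + k) - w (m + k + 1)) = w (m + 0) - w (m + (N - m + 1)) := by
      rw [← sum_range_sub' (fun k => w (m + k)) (N - m + 1)]
      exact sum_congr rfl fun k _ => by rw [add_assoc]
    rw [key, add_zero, hwt (m + (N - m + 1)) (by omega), sub_zero]

/-- **MONOTONICITY FOR ALL ADMISSIBLE INPUTS FROM THE TRUNCATIONS.**  A map `D` on inputs that is LINEAR on zero-tailed inputs (`D (Σ a_j u_j) = Σ a_j D u_j`)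
— e.g. any composite of reads and zero-tailed solution operators, `w ↦ RL i (SL i (SA (i+1) w))` — produces a non-increasing sequence for EVERY non-negative
non-increasing zero-tailed input as soon as it does for the truncations `1_{[0,j]}`, `j ≤ N`. [folklore] -/
theorem antitone_of_truncations {D : (ℕ → ℝ) → ℕ → ℝ}
    (hlin : ∀ (s : Finset ℕ) (a : ℕ → ℝ) (u : ℕ → ℕ → ℝ), (∀ j ∈ s, ∀ m, N < m → u j m = 0) →
      ∀ m, D (fun m => ∑ j ∈ s, a j * u j m) m = ∑ j ∈ s, a j * D (u j) m)
    (htrunc : ∀ j, j ≤ N → ∀ m, D (fun m => if m ≤ j then (1:ℝ) else 0) (m + 1) ≤ D (fun m => if m ≤ j then (1:ℝ) else 0) m)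
    {w : ℕ → ℝ} (hwa : ∀ m, w (m + 1) ≤ w m) (hwt : ∀ m, N < m → w m = 0) : ∀ m, D w (m + 1) ≤ D w m := by
  have hw : w = fun m => ∑ j ∈ range (N + 1), (w j - w (j + 1)) * (fun j m => if m ≤ j then (1:ℝ) else 0) j m :=
    funext fun m => eq_sum_truncations hwt m
  intro m
  have hz : ∀ j ∈ range (N + 1), ∀ m', N < m' → (fun j m => if m ≤ j then (1:ℝ) else 0) j m' = 0 :=
    fun j hj m' hm' => by beta_reduce; exact if_neg (by have := mem_range.mp hj; omega)
  rw [hw, hlin _ _ _ hz, hlin _ _ _ hz]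
  refine sum_le_sum fun j hj => mul_le_mul_of_nonneg_left (htrunc j (by have := mem_range.mp hj; omega) m) (by linarith [hwa j])

end Linear

/-! ## §4 (append, gen 72) The per-pin growth with the entering lags credited -/

section Sharp

variable {N n : ℕ} {KL KA : ℕ → ℕ → ℕ → ℝ} {RL RA : ℕ → (ℕ → ℝ) → ℕ → ℝ} {y : ℕ → ℕ} {θ : ℕ → ℕ → ℕ → ℝ}


/-- **PER-PIN GROWTH, SHARP.**  Level `i` (ages `> i` with lone kernels `KL ≥ 0`, windows `1 ≤ y_k ≤ N`, persistence defects `θ ≥ 0` at lag one); `v ≥ 0` the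
surplus of the ages `> i` for a non-increasing input `w`; at the pin `m` the drops are bounded by carried ratios `β`; marks `s_k` with
`s_k·KL k (m+1) (y_k−1)·v (m+1) ≤ KL k (m+1) (y_k−1)·v (m+1+y_k)` (`s_k = 1` allowed where `v (m+1) ≤ v (m+1+y_k)`, `s_k = 0` always).  Then
**`(1 − Σ_{k∈(i,n]} (KL k m 0 − s_k·KL k (m+1) (y_k−1)))·v (m+1) ≤ (1 + Σ_{k∈(i,n]} θ k m 1·β_k)·v m`**. [folklore] -/
theorem per_pin_growth_sharp
    (hKL : ∀ i m l, 0 ≤ KL i m l) (hKLN : ∀ i m l, N ≤ l → KL i m l = 0) (hKLy : ∀ i m l, y i ≤ l → KL i m l = 0)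
    {i : ℕ} (hy : ∀ k, i < k → k ≤ n → 1 ≤ y k ∧ y k ≤ N)
    (hRL : ∀ i v m, RL i v m = ∑ l ∈ range N, KL i m l * v (m + 1 + l))
    (hRA : ∀ i v m, RA i v m = ∑ l ∈ range N, KA i m l * v (m + 1 + l))
    (hKA : ∀ i m l, KA i m l = KL i m l + KA (i + 1) m l) (hKAtop : ∀ m l, KA (n + 1) m l = 0)
    (hθ0 : ∀ k m l, 0 ≤ θ k m l) (hpers : ∀ k m l i', (1 - θ k m l) * KL k m (i' + l) ≤ KL k (m + l) i')
    (hin : i ≤ n) {v w : ℕ → ℝ} (hv0 : ∀ m, 0 ≤ v m) (hw : ∀ m, w (m + 1) ≤ w m) (heq : ∀ m, v m = w m - RA (i + 1) v m)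
    {m : ℕ} {β : ℕ → ℝ} (hdrop : ∀ k, i < k → k ≤ n → RL k v m ≤ β k * v m)
    {s : ℕ → ℝ} (hs : ∀ k, i < k → k ≤ n → s k * KL k (m + 1) (y k - 1) * v (m + 1) ≤ KL k (m + 1) (y k - 1) * v (m + 1 + y k)) :
    (1 - ∑ k ∈ Ioc i n, (KL k m 0 - s k * KL k (m + 1) (y k - 1))) * v (m + 1) ≤ (1 + ∑ k ∈ Ioc i n, θ k m 1 * β k) * v m := by
  -- the aggregate read as the sum of the lone reads of the ages > i
  have hagg : ∀ m', RA (i + 1) v m' = ∑ k ∈ Ioc i n, RL k v m' := by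
    intro m'
    rw [hRA]
    have e : ∀ l ∈ range N, KA (i + 1) m' l * v (m' + 1 + l) = ∑ k ∈ Ioc i n, KL k m' l * v (m' + 1 + l) := fun l _ => by
      rw [aggregate_eq_sum hKA hKAtop (by omega : i + 1 ≤ n + 1), sum_mul]
      have hset : Ico (i + 1) (n + 1) = Ioc i n := by ext k; simp only [mem_Ico, mem_Ioc]; omega
      rw [hset]
    rw [sum_congr rfl e, sum_comm]
    exact sum_congr rfl fun k _ => by rw [hRL]
  -- per age: the drop one pin deeper keeps the persisting part and gains the entering read
  have hstep : ∀ k ∈ Ioc i n, RL k v m - RL k v (m + 1) ≤ θ k m 1 * β k * v m + (KL k m 0 - s k * KL k (m + 1) (y k - 1)) * v (m + 1) := by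
    intro k hk
    have hk' := mem_Ioc.mp hk
    obtain ⟨hyk1, hykN⟩ := hy k hk'.1 hk'.2
    obtain ⟨N', hN'⟩ : ∃ N', N = N' + 1 := ⟨N - 1, by omega⟩
    -- RL k v m = KL k m 0 v(m+1) + T,  T = Σ_{l<N'} KL k m (l+1) v(m+2+l)
    have hRm : RL k v m = KL k m 0 * v (m + 1) + ∑ l ∈ range N', KL k m (l + 1) * v (m + 2 + l) := by
      rw [hRL, hN', sum_range_succ', add_comm]
      simp only [add_zero]
      congr 1
      exact sum_congr rfl fun l _ => by rw [show m + 1 + (l + 1) = m + 2 + l by omega]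
    -- RL k v (m+1) = Σ_{l<N} a_l, a_l = KL k (m+1) l v(m+2+l) ≥ b_l = (1−θ) KL k m (l+1) v(m+2+l); and a_{y_k−1} − b_{y_k−1} = a_{y_k−1}
    have hab : ∀ l ∈ range N, (1 - θ k m 1) * KL k m (l + 1) * v (m + 2 + l) ≤ KL k (m + 1) l * v (m + 2 + l) := fun l _ =>
      mul_le_mul_of_nonneg_right (hpers k m 1 l) (hv0 _)
    have hRm1 : RL k v (m + 1) = ∑ l ∈ range N, KL k (m + 1) l * v (m + 2 + l) := by rw [hRL]
    have hsumb : ∑ l ∈ range N, (1 - θ k m 1) * KL k m (l + 1) * v (m + 2 + l) = (1 - θ k m 1) * ∑ l ∈ range N', KL k m (l + 1) * v (m + 2 + l) := by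
      rw [hN', sum_range_succ, hKLN k m (N' + 1) (by omega), mul_zero, zero_mul, add_zero, mul_sum]
      exact sum_congr rfl fun l _ => by ring
    -- extract the entering lag l₀ = y_k − 1 (where b_{l₀} = 0)
    have hl0 : y k - 1 ∈ range N := mem_range.mpr (by omega)
    have hb0 : (1 - θ k m 1) * KL k m (y k - 1 + 1) * v (m + 2 + (y k - 1)) = 0 := by
      rw [show y k - 1 + 1 = y k by omega, hKLy k m (y k) le_rfl, mul_zero, zero_mul]
    have hlow : (1 - θ k m 1) * ∑ l ∈ range N', KL k m (l + 1) * v (m + 2 + l) + KL k (m + 1) (y k - 1) * v (m + 1 + y k) ≤ RL k v (m + 1) := by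
      rw [hRm1, ← hsumb]
      -- Σ a − Σ b = Σ (a − b) ≥ (a − b) at l₀ = a_{l₀}
      have hdiff : KL k (m + 1) (y k - 1) * v (m + 2 + (y k - 1)) - (1 - θ k m 1) * KL k m (y k - 1 + 1) * v (m + 2 + (y k - 1)) ≤
          ∑ l ∈ range N, (KL k (m + 1) l * v (m + 2 + l) - (1 - θ k m 1) * KL k m (l + 1) * v (m + 2 + l)) :=
        single_le_sum (f := fun l => KL k (m + 1) l * v (m + 2 + l) - (1 - θ k m 1) * KL k m (l + 1) * v (m + 2 + l))
          (fun l hl => by linarith [hab l hl]) hl0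
      rw [hb0, sub_zero, show m + 2 + (y k - 1) = m + 1 + y k by omega, sum_sub_distrib] at hdiff
      linarith
    have hT0 : 0 ≤ ∑ l ∈ range N', KL k m (l + 1) * v (m + 2 + l) := sum_nonneg fun l _ => mul_nonneg (hKL k m _) (hv0 _)
    have hθ := hθ0 k m 1
    have hd := hdrop k hk'.1 hk'.2
    have hsk := hs k hk'.1 hk'.2
    rw [hRm] at hd ⊢
    nlinarith [hlow, mul_nonneg hθ hT0, mul_nonneg hθ (mul_nonneg (hKL k m 0) (hv0 (m + 1))), hsk]
  -- sum over the ages > i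
  have hsum := sum_le_sum hstep
  rw [sum_sub_distrib, ← hagg, ← hagg, sum_add_distrib, ← sum_mul, ← sum_mul] at hsum
  have hv : v (m + 1) - v m ≤ RA (i + 1) v m - RA (i + 1) v (m + 1) := by rw [heq m, heq (m + 1)]; linarith [hw m]
  nlinarith [hsum, hv]

end Sharp

end Summit.QuantumFields.BalabanUV.Beta.EriceRemainderEnclosureHistoryAutonomyComparisonAgeCompositionStaticWiring

end
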